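import Literature.NumberTheory.Sieve.SieveFrameworkFundamentalLemma
import Literature.NumberTheory.Sieve.ParityBarrierProofs
import Literature.NumberTheory.LFunctions.MertensTail
import HarnessLib

/-!
# Rough numbers in arithmetic progressions (Hooley's Lemma 8)

Topic `Literature/NumberTheory/Sieve`.  Third layer of the decomposition of the named fact
`Literature.NumberTheory.Sieve.hooley_polyRoots_logPowerSaving` (`PolynomialCongruences.lean`, Hooley 1964 as printed in
Dartyge–Martin 2019, Lemma 5): the auxiliary counting result of Hooley (1964) that "makes no
reference to the polynomial" (Martin–Sitar, Mathematika 57, §3.2: "his Lemma 7–Lemma 8"), in the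
generality in which the assembly uses it.  Everything is PROVED (no `sorry`) and the file
introduces NO definitions: the progression sequence `m ≡ b (mod q)` (Halberstam–Richert Ch. 1,
Example 3: `a_n = [n ≡ b (q)]`, `X(y) = y/q`, density `g_q(d) = 1/d` on `(d, q) = 1`, `0`
otherwise) is an explicit `SieveSequence` term built inside the proof of the main result, and the
auxiliary lemmas are stated for any `A : SieveSequence` with these fields (hypotheses `hAa`, `hAs`,
`hAd`).  (The smooth–rough factorisation that organises Hooley's `Σ₁ + Σ₂` is the tree's
`Literature.NumberTheory.Sieve.smoothPart`, `BombieriAsymptoticSieveSmoothPart.lean`, used by the assembly file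
`PolynomialCongruencesLogPowerSaving.lean`.)  A Brun–Titchmarsh bound of the same shape with an additive
`z^{10}` term, via the tree's beta-sieve upper bound instead of the Fundamental Lemma, is
`Literature.NumberTheory.Sieve.card_roughAP_le` (`RoughNumbersInProgressions.lean`); the form below (hypothesis `q X³ ≤ y`,
no additive term, arbitrary finite set `T`) is the one consumed by the assembly.

* the progression sequence: `g_q` is multiplicative (`isMultiplicative_apDensity`) of sieve
  dimension `1` (`hasSieveDimension_apDensity`, via the tree's
  `hasSieveDimension_reciprocalDensity_one_holds`); `|R_d(y)| ≤ 2` for `(b, q) = 1`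
  (`abs_remainder_apSeq_le`: a residue class modulo `dq` in `(0, ⌊y⌋]` has `y/(dq) + O(1)` elements,
  `abs_card_Ioc_filter_modEq_sub_le`, and for `(d, q) > 1` both `A_d` and `g_q(d)` vanish);
  `V(z) ≤ (q/φ(q)) ∏_{p<z} (1 − 1/p)` (`densityProduct_apSeq_le`).
* `card_rough_congr_le` — **Hooley's Lemma 8** (Zehavi 2020, Lemma 3.6 "[5, Lemma 8] If `a`, `λ`
  and `y` satisfy the conditions `y ≥ x^{2/3}`, `λ ≤ x^{1/3}` and `(a, λ) = 1`, then
  `∑_{ℓ₂ ≤ y, ℓ₂ ≡ a (λ)} …`" — the displayed bound is not in the held text layer; `ℓ₂` runs over the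
  integers all of whose prime factors exceed `X`, and the sieve bound for this count, which is what
  the assembly consumes, is `O(y/(φ(λ) log X))`): there is an absolute `C` such that for `q ≥ 1`,
  `(b, q) = 1`, `X ≥ 3` and `q X³ ≤ y`,
  `#{m ≤ y : m ≡ b (mod q), p ∣ m ⇒ p > X} ≤ C y / (φ(q) log X)`
  (stated for an arbitrary finite set `T` of such `m`).
  Proof: the upper-bound direction of the Fundamental Lemma of sieve theory (the tree's
  `SieveSequence.fundamental_lemma_uniform_holds`, dimension `1`) for the progression sifted by the
  primes `p < X` at level `D = X²`, the remainder bound `∑_{d ≤ X²} |R_d| ≤ 2X² ≤ 2y/(φ(q) log X)`,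
  and Mertens' bound `∏_{p < X} (1 − 1/p) ≤ C₀/log X`, `C₀ = 4 e^{6/log 2} log 2`
  (`prod_primesBelow_one_sub_inv_le`, from `MertensBound.prod_one_sub_inv_prime_Icc_le`).

## References

* C. Hooley, *On the distribution of the roots of polynomial congruences*, Mathematika 11 (1964),
  39–49, Lemma 8 (original not held; statement quoted from the next item). [cite: Hooley1964, Lemma 8]
* S. Zehavi, *On the joint distribution of the roots of pairs of polynomial congruences*,
  arXiv:2003.13100 (2020), §3.1, Lemma 3.6. [cite: Zehavi2020, Lemma 3.6]
* G. Martin, S. Sitar, *Erdős–Turán with a moving target, equidistribution of roots of reducible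
  quadratics, and Diophantine quadruples*, Mathematika 57 (2011), 1–29, §3.2. [cite: MartinSitar2010, §3.2]
* H. Halberstam, H.-E. Richert, *Sieve Methods*, Academic Press 1974, Ch. 1 Example 3 (the
  progression as a sifted sequence) and Thm 2.5 (Fundamental Lemma). [cite: HalberstamRichert1974, Thm 2.5]

## Mathlib

Used: `Nat.Ioc_filter_modEq_card`, `Nat.chineseRemainder`, `Nat.modEq_and_modEq_iff_modEq_mul`,
`Nat.ModEq.gcd_eq`, `Nat.totient_eq_mul_prod_factors` (via the tree's
`MertensBound.totient_eq_mul_prod_one_sub_inv`), `Finset.prod_le_prod_of_subset_of_le_one`.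
-/

noncomputable section

open Finset Real
open scoped Nat

namespace Literature.NumberTheory.Sieve

/-! ### The progression `b mod q` as a sifted sequence

No definition is introduced: the lemmas below are stated for an arbitrary `A : SieveSequence`
whose fields are those of the progression sequence (hypotheses `hAa`, `hAs`, `hAd`), and the
sequence itself is built as an explicit term inside the proof of `card_rough_congr_le`. -/

/-- The density `g_q(d) = [d ≥ 1, (d, q) = 1] / d` of a progression to modulus `q`
(Halberstam–Richert Ch. 1, Example 3), as an explicit arithmetic function, is multiplicative.
[folklore] -/
theorem isMultiplicative_apDensity (q : ℕ) :
    ArithmeticFunction.IsMultiplicative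
      (⟨fun d : ℕ => if d ≠ 0 ∧ d.Coprime q then (d : ℝ)⁻¹ else 0, by simp⟩ :
        ArithmeticFunction ℝ) := by
  set g : ArithmeticFunction ℝ :=
    ⟨fun d : ℕ => if d ≠ 0 ∧ d.Coprime q then (d : ℝ)⁻¹ else 0, by simp⟩ with hg
  have happ : ∀ d : ℕ, g d = if d ≠ 0 ∧ d.Coprime q then (d : ℝ)⁻¹ else 0 := fun d => rfl
  refine ⟨by rw [happ]; simp, fun {m n} hmn => ?_⟩
  have _ := hmn
  rcases eq_or_ne m 0 with rfl | hm
  · simp [happ]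
  rcases eq_or_ne n 0 with rfl | hn
  · simp [happ]
  rw [happ, happ, happ]
  by_cases h1 : m.Coprime q
  · by_cases h2 : n.Coprime q
    · rw [if_pos ⟨mul_ne_zero hm hn, Nat.Coprime.mul_left h1 h2⟩, if_pos ⟨hm, h1⟩, if_pos ⟨hn, h2⟩,
        Nat.cast_mul, mul_inv]
    · rw [if_neg (show ¬ (m * n ≠ 0 ∧ (m * n).Coprime q) from
          fun h => h2 (Nat.Coprime.coprime_mul_left h.2)),
        if_neg (show ¬ (n ≠ 0 ∧ n.Coprime q) from fun h => h2 h.2), mul_zero]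
  · rw [if_neg (show ¬ (m * n ≠ 0 ∧ (m * n).Coprime q) from
        fun h => h1 (Nat.Coprime.coprime_mul_right h.2)),
      if_neg (show ¬ (m ≠ 0 ∧ m.Coprime q) from fun h => h1 h.2), zero_mul]

section AP

variable {q b : ℕ} {A : SieveSequence}

/-- At a prime, `g_q(p) = 1/p` or `0`. [folklore] -/
theorem apDensity_prime (hAd : ∀ d : ℕ, A.density d = if d ≠ 0 ∧ d.Coprime q then (d : ℝ)⁻¹ else 0)
    {p : ℕ} (hp : p.Prime) :
    A.density p = if p.Coprime q then (p : ℝ)⁻¹ else 0 := by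
  rw [hAd]
  by_cases h : p.Coprime q
  · rw [if_pos ⟨hp.ne_zero, h⟩, if_pos h]
  · rw [if_neg (fun h' => h h'.2), if_neg h]

/-- The density `g_q` has sieve dimension `1` with the same constant as `d ↦ 1/d`
(termwise `(1 − g_q(p))⁻¹ ≤ (1 − 1/p)⁻¹`). [folklore] -/
theorem hasSieveDimension_apDensity
    (hAd : ∀ d : ℕ, A.density d = if d ≠ 0 ∧ d.Coprime q then (d : ℝ)⁻¹ else 0)
    {K : ℝ} (hK : HasSieveDimension reciprocalDensity 1 K) : HasSieveDimension A.density 1 K := by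
  refine ⟨fun p hp => ?_, fun w z hw hwz => ?_⟩
  · rw [apDensity_prime hAd hp]
    split_ifs
    · exact ⟨inv_nonneg.2 (Nat.cast_nonneg p), inv_lt_one_of_one_lt₀ (by exact_mod_cast hp.one_lt)⟩
    · exact ⟨le_rfl, one_pos⟩
  · refine le_trans (Finset.prod_le_prod (fun p hp => ?_) (fun p hp => ?_)) (hK.2 w z hw hwz)
    · have hp' : p.Prime := Nat.prime_of_mem_primesBelow (Finset.mem_filter.1 hp).1
      rw [apDensity_prime hAd hp']
      split_ifs
      · exact inv_nonneg.2 (sub_nonneg.2 (Nat.cast_inv_le_one p))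
      · norm_num
    · have hp' : p.Prime := Nat.prime_of_mem_primesBelow (Finset.mem_filter.1 hp).1
      have hp1 : (1 : ℝ) < p := by exact_mod_cast hp'.one_lt
      rw [apDensity_prime hAd hp', reciprocalDensity_apply]
      split_ifs
      · exact le_rfl
      · rw [sub_zero, inv_one]
        exact (one_le_inv₀ (sub_pos.2 (inv_lt_one_of_one_lt₀ hp1))).2
          (sub_le_self _ (inv_nonneg.2 (Nat.cast_nonneg p)))

/-! ### Counting a residue class -/

/-- Counting a residue class in `(0, N]`: `|#{n ≤ N : n ≡ v (mod m)} − N/m| ≤ 1`. [folklore] -/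
theorem abs_card_Ioc_filter_modEq_sub_le {m : ℕ} (hm : 0 < m) (N v : ℕ) :
    |(#((Ioc 0 N).filter fun n : ℕ => n ≡ v [MOD m]) : ℝ) - N / m| ≤ 1 := by
  have h := Nat.Ioc_filter_modEq_card 0 N hm v
  have hm' : (0 : ℚ) < m := by exact_mod_cast hm
  set A : ℚ := ((N : ℕ) - v : ℚ) / m with hA
  set B : ℚ := ((0 : ℕ) - v : ℚ) / m with hB
  have hBA : B ≤ A := by
    rw [hA, hB]
    refine div_le_div_of_nonneg_right (sub_le_sub_right ?_ _) hm'.le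
    exact_mod_cast Nat.zero_le N
  have h0 : 0 ≤ ⌊A⌋ - ⌊B⌋ := sub_nonneg.2 (Int.floor_mono hBA)
  rw [max_eq_left h0] at h
  have hAB : A - B = (N : ℚ) / m := by
    rw [hA, hB]; push_cast; field_simp; ring
  have key : |((#((Ioc 0 N).filter fun n : ℕ => n ≡ v [MOD m]) : ℕ) : ℚ) - (N : ℚ) / m| ≤ 1 := by
    have h' : (((#((Ioc 0 N).filter fun n : ℕ => n ≡ v [MOD m]) : ℕ) : ℤ) : ℚ) =
        ((⌊A⌋ - ⌊B⌋ : ℤ) : ℚ) := by rw [h]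
    push_cast at h'
    rw [h', ← hAB, abs_le]
    constructor <;>
      linarith [Int.floor_le A, Int.lt_floor_add_one A, Int.floor_le B, Int.lt_floor_add_one B]
  have := (Rat.cast_le (K := ℝ)).2 key
  push_cast at this
  exact this

/-- The conditions `d ∣ m`, `m ≡ b (mod q)` for `(d, q) = 1` form a single residue class modulo
`dq` (Chinese remainder theorem). [folklore] -/
theorem exists_filter_dvd_and_modEq_eq {d q : ℕ} (hdq : d.Coprime q) (b : ℕ) (s : Finset ℕ) :
    ∃ c : ℕ, s.filter (fun m => d ∣ m ∧ m ≡ b [MOD q]) = s.filter (fun m => m ≡ c [MOD d * q]) := by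
  obtain ⟨c, hc⟩ := Nat.chineseRemainder hdq 0 b
  refine ⟨c, Finset.filter_congr fun m _ => ?_⟩
  rw [← Nat.modEq_and_modEq_iff_modEq_mul hdq, ← Nat.modEq_zero_iff_dvd]
  exact ⟨fun h => ⟨h.1.trans hc.1.symm, h.2.trans hc.2.symm⟩,
    fun h => ⟨h.1.trans hc.1, h.2.trans hc.2⟩⟩

/-- `A_d(y)` for the progression sequence counts `m ≤ y` with `d ∣ m`, `m ≡ b (mod q)`. [folklore] -/
theorem congrSum_apSeq (hAa : ∀ n : ℕ, A.a n = if n ≡ b [MOD q] then 1 else 0) (d : ℕ) (y : ℝ) :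
    A.congrSum d y = #((Ioc 0 ⌊y⌋₊).filter fun m => d ∣ m ∧ m ≡ b [MOD q]) := by
  rw [SieveSequence.congrSum]
  simp only [hAa]
  rw [Finset.sum_boole, Finset.filter_filter]

/-- The remainders of the progression sequence are at most `2` in absolute value, for every `d`,
as soon as `(b, q) = 1`: for `(d, q) = 1` the count of a residue class modulo `dq` in `(0, ⌊y⌋]` is
`y/(dq) + O(1)`, and for `(d, q) > 1` both `A_d` and `g_q(d)` vanish. [folklore] -/
theorem abs_remainder_apSeq_le (hAa : ∀ n : ℕ, A.a n = if n ≡ b [MOD q] then 1 else 0)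
    (hAs : ∀ y : ℝ, A.size y = y / q)
    (hAd : ∀ d : ℕ, A.density d = if d ≠ 0 ∧ d.Coprime q then (d : ℝ)⁻¹ else 0)
    (hq : 0 < q) (hbq : b.Coprime q) (d : ℕ) {y : ℝ} (hy : 0 ≤ y) : |A.remainder d y| ≤ 2 := by
  rw [SieveSequence.remainder, congrSum_apSeq hAa, hAd, hAs]
  by_cases hd : d ≠ 0 ∧ d.Coprime q
  · obtain ⟨hd0, hdq⟩ := hd
    rw [if_pos ⟨hd0, hdq⟩]
    obtain ⟨c, hc⟩ := exists_filter_dvd_and_modEq_eq hdq b (Ioc 0 ⌊y⌋₊)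
    rw [hc]
    have hdq0 : 0 < d * q := Nat.mul_pos (Nat.pos_of_ne_zero hd0) hq
    have h1 := abs_card_Ioc_filter_modEq_sub_le hdq0 ⌊y⌋₊ c
    have hdqR : (0 : ℝ) < d * q := by exact_mod_cast hdq0
    have h2 : |(⌊y⌋₊ : ℝ) / (d * q : ℕ) - (d : ℝ)⁻¹ * (y / q)| ≤ 1 := by
      have hd' : (d : ℝ) ≠ 0 := by exact_mod_cast hd0
      have hq' : (q : ℝ) ≠ 0 := by exact_mod_cast hq.ne'
      have e : (d : ℝ)⁻¹ * (y / q) = y / (d * q) := by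
        field_simp
      rw [Nat.cast_mul, e, ← sub_div, abs_div, abs_of_pos hdqR, div_le_one hdqR]
      have hf1 := Nat.floor_le hy
      have hf2 := Nat.lt_floor_add_one y
      have h1dq : (1 : ℝ) ≤ d * q := by exact_mod_cast hdq0
      rw [abs_le]
      constructor <;> nlinarith
    calc |(#((Ioc 0 ⌊y⌋₊).filter fun m : ℕ => m ≡ c [MOD d * q]) : ℝ) - (d : ℝ)⁻¹ * (y / q)|
        = |((#((Ioc 0 ⌊y⌋₊).filter fun m : ℕ => m ≡ c [MOD d * q]) : ℝ) - ⌊y⌋₊ / (d * q : ℕ)) +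
            ((⌊y⌋₊ : ℝ) / (d * q : ℕ) - (d : ℝ)⁻¹ * (y / q))| := by ring_nf
      _ ≤ |(#((Ioc 0 ⌊y⌋₊).filter fun m : ℕ => m ≡ c [MOD d * q]) : ℝ) - ⌊y⌋₊ / (d * q : ℕ)| +
            |(⌊y⌋₊ : ℝ) / (d * q : ℕ) - (d : ℝ)⁻¹ * (y / q)| := abs_add_le _ _
      _ ≤ 1 + 1 := add_le_add h1 h2
      _ = 2 := by norm_num
  · rw [if_neg hd]
    have hempty : (Ioc 0 ⌊y⌋₊).filter (fun m => d ∣ m ∧ m ≡ b [MOD q]) = ∅ := by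
      refine Finset.filter_eq_empty_iff.2 fun m hm h => ?_
      have hm0 : 0 < m := (Finset.mem_Ioc.1 hm).1
      rcases eq_or_ne d 0 with rfl | hd0
      · exact hm0.ne' (zero_dvd_iff.1 h.1)
      · have hmq : m.Coprime q := by
          have := h.2.gcd_eq
          rw [Nat.Coprime, this]; exact hbq
        exact hd ⟨hd0, Nat.Coprime.coprime_dvd_left h.1 hmq⟩
    rw [hempty, card_empty, Nat.cast_zero, zero_mul, sub_zero, abs_zero]
    norm_num

/-- The `X`-rough members of the progression in `(0, y]` are counted by the sifting function of
the progression sequence with sifting range `P(X) = ∏_{p < X} p`. [folklore] -/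
theorem card_rough_congr_le_sifted (hAa : ∀ n : ℕ, A.a n = if n ≡ b [MOD q] then 1 else 0)
    (X y : ℝ) {T : Finset ℕ}
    (hT : ∀ m ∈ T, m ≠ 0 ∧ (m : ℝ) ≤ y ∧ m ≡ b [MOD q] ∧ ∀ p : ℕ, p.Prime → p ∣ m → X < (p : ℝ)) :
    (#T : ℝ) ≤ A.sifted y (primesProdBelow X) := by
  have hR : A.sifted y (primesProdBelow X) =
      #(((Ioc 0 ⌊y⌋₊).filter fun n : ℕ => n.Coprime (primesProdBelow X)).filter
        fun n : ℕ => n ≡ b [MOD q]) := by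
    rw [SieveSequence.sifted]
    simp only [hAa]
    rw [Finset.sum_boole]
  rw [hR]
  exact_mod_cast Finset.card_le_card fun m hm => by
    obtain ⟨hm0, hmy, hmb, hmr⟩ := hT m hm
    simp only [Finset.mem_filter, Finset.mem_Ioc]
    refine ⟨⟨⟨Nat.pos_of_ne_zero hm0, Nat.le_floor hmy⟩,
      (coprime_primesProdBelow_iff m X).2 fun p hp hpm => ?_⟩, hmb⟩
    rw [Nat.mem_primesBelow] at hp
    exact lt_asymm (Nat.lt_ceil.1 hp.1) (hmr p hp.2 hpm)

/-- `V(z)` for the progression sequence: removing the local factors at `p ∣ q` costs at most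
`q/φ(q)`: `∏_{p < z} (1 − g_q(p)) ≤ (q/φ(q)) ∏_{p < z} (1 − 1/p)`. [folklore] -/
theorem densityProduct_apSeq_le
    (hAd : ∀ d : ℕ, A.density d = if d ≠ 0 ∧ d.Coprime q then (d : ℝ)⁻¹ else 0)
    (hq : 0 < q) (z : ℝ) :
    A.densityProduct (primesProdBelow z) ≤
      (q : ℝ) / φ q * ∏ p ∈ Nat.primesBelow ⌈z⌉₊, (1 - (p : ℝ)⁻¹) := by
  rw [SieveSequence.densityProduct, primeFactors_primesProdBelow]
  set S := Nat.primesBelow ⌈z⌉₊ with hS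
  have hV : ∏ p ∈ S, (1 - A.density p) = ∏ p ∈ S.filter (fun p => p.Coprime q), (1 - (p : ℝ)⁻¹) := by
    rw [Finset.prod_filter]
    refine Finset.prod_congr rfl fun p hp => ?_
    rw [apDensity_prime hAd (Nat.prime_of_mem_primesBelow hp)]
    split_ifs <;> simp
  have hsplit : ∏ p ∈ S, (1 - (p : ℝ)⁻¹) =
      (∏ p ∈ S.filter (fun p => p.Coprime q), (1 - (p : ℝ)⁻¹)) *
        ∏ p ∈ S.filter (fun p => ¬ p.Coprime q), (1 - (p : ℝ)⁻¹) :=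
    (Finset.prod_filter_mul_prod_filter_not S _ _).symm
  -- the factors at `p ∣ q` have product at least `φ(q)/q`
  have hφ : (φ q : ℝ) / q = ∏ p ∈ q.primeFactors, (1 - (p : ℝ)⁻¹) := by
    rw [LFunctions.MertensBound.totient_eq_mul_prod_one_sub_inv q]
    have hq' : (q : ℝ) ≠ 0 := by exact_mod_cast hq.ne'
    rw [mul_div_cancel_left₀ _ hq']
    simp [one_div]
  have hT : (φ q : ℝ) / q ≤ ∏ p ∈ S.filter (fun p => ¬ p.Coprime q), (1 - (p : ℝ)⁻¹) := by
    rw [hφ]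
    refine Finset.prod_le_prod_of_subset_of_le_one (fun p hp => ?_) (fun p hp => ?_)
      (fun p hp _ => ?_)
    · rw [Finset.mem_filter] at hp
      have hp' := Nat.prime_of_mem_primesBelow hp.1
      exact Nat.mem_primeFactors.2 ⟨hp', not_not.1 ((hp'.coprime_iff_not_dvd).not.1 hp.2), hq.ne'⟩
    · exact sub_nonneg.2 (Nat.cast_inv_le_one p)
    · exact sub_le_self _ (inv_nonneg.2 (Nat.cast_nonneg p))
  have hφpos : (0 : ℝ) < (φ q : ℝ) / q :=
    div_pos (by exact_mod_cast Nat.totient_pos.2 hq) (by exact_mod_cast hq)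
  have hTpos : 0 < ∏ p ∈ S.filter (fun p => ¬ p.Coprime q), (1 - (p : ℝ)⁻¹) := hφpos.trans_le hT
  have hP0 : 0 ≤ ∏ p ∈ S, (1 - (p : ℝ)⁻¹) :=
    Finset.prod_nonneg fun p _ => sub_nonneg.2 (Nat.cast_inv_le_one p)
  have hVeq : ∏ p ∈ S.filter (fun p => p.Coprime q), (1 - (p : ℝ)⁻¹) =
      (∏ p ∈ S, (1 - (p : ℝ)⁻¹)) / ∏ p ∈ S.filter (fun p => ¬ p.Coprime q), (1 - (p : ℝ)⁻¹) := by
    rw [hsplit, mul_div_cancel_right₀ _ hTpos.ne']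
  rw [hV, hVeq]
  calc (∏ p ∈ S, (1 - (p : ℝ)⁻¹)) / ∏ p ∈ S.filter (fun p => ¬ p.Coprime q), (1 - (p : ℝ)⁻¹)
      ≤ (∏ p ∈ S, (1 - (p : ℝ)⁻¹)) / ((φ q : ℝ) / q) := div_le_div_of_nonneg_left hP0 hφpos hT
    _ = (q : ℝ) / φ q * ∏ p ∈ S, (1 - (p : ℝ)⁻¹) := by
        rw [div_div_eq_mul_div, div_eq_mul_inv, mul_comm, div_eq_mul_inv]
        ring

end AP

/-- **Mertens' product bound** in the form `∏_{p < z} (1 − 1/p) ≤ C₀ / log z` for `z ≥ 3`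
(from `MertensBound.prod_one_sub_inv_prime_Icc_le` on `[2, z − 1]` and `log (z − 1) ≥ ½ log z`).
[folklore] -/
theorem prod_primesBelow_one_sub_inv_le {z : ℝ} (hz : 3 ≤ z) :
    ∏ p ∈ Nat.primesBelow ⌈z⌉₊, (1 - (p : ℝ)⁻¹) ≤ (4 * Real.exp (6 / Real.log 2) * Real.log 2) / Real.log z := by
  have hz1 : (2 : ℝ) ≤ z - 1 := by linarith
  have hsub : (Icc ⌈(2 : ℝ)⌉₊ ⌊z - 1⌋₊).filter Nat.Prime ⊆ Nat.primesBelow ⌈z⌉₊ := by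
    intro p hp
    rw [Finset.mem_filter, Finset.mem_Icc] at hp
    refine Nat.mem_primesBelow.2 ⟨Nat.lt_ceil.2 ?_, hp.2⟩
    have : (p : ℝ) ≤ z - 1 := (Nat.le_floor_iff (by linarith)).1 hp.1.2
    linarith
  have h1 : ∏ p ∈ Nat.primesBelow ⌈z⌉₊, (1 - (p : ℝ)⁻¹) ≤
      ∏ p ∈ (Icc ⌈(2 : ℝ)⌉₊ ⌊z - 1⌋₊).filter Nat.Prime, (1 - (p : ℝ)⁻¹) :=
    Finset.prod_le_prod_of_subset_of_le_one hsub (fun p _ => sub_nonneg.2 (Nat.cast_inv_le_one p))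
      fun p _ _ => sub_le_self _ (inv_nonneg.2 (Nat.cast_nonneg p))
  have h2 := LFunctions.MertensBound.prod_one_sub_inv_prime_Icc_le (le_refl (2 : ℝ)) hz1
  refine (h1.trans h2).trans ?_
  have hlog2 : 0 < Real.log 2 := Real.log_pos (by norm_num)
  have hlogz : 0 < Real.log z := Real.log_pos (by linarith)
  -- `log (z - 1) ≥ log z / 2` since `(z - 1)² ≥ z` for `z ≥ 3`
  have hsq : Real.sqrt z ≤ z - 1 := by
    rw [Real.sqrt_le_left (by linarith)]
    nlinarith
  have hlogz1 : Real.log z / 2 ≤ Real.log (z - 1) := by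
    rw [← Real.log_sqrt (by linarith)]
    exact Real.log_le_log (Real.sqrt_pos.2 (by linarith)) hsq
  have hlz1 : 0 < Real.log (z - 1) := by linarith
  have h3 : Real.log 2 / Real.log (z - 1) ≤ 2 * Real.log 2 / Real.log z := by
    rw [div_le_div_iff₀ hlz1 hlogz]
    nlinarith
  have h4 : 0 ≤ Real.exp (6 / Real.log 2) * Real.log 2 / Real.log z := by positivity
  calc Real.exp (6 / Real.log 2) * (Real.log 2 / Real.log (z - 1))
      ≤ Real.exp (6 / Real.log 2) * (2 * Real.log 2 / Real.log z) :=
        mul_le_mul_of_nonneg_left h3 (Real.exp_pos _).le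
    _ = 2 * (Real.exp (6 / Real.log 2) * Real.log 2 / Real.log z) := by ring
    _ ≤ 4 * (Real.exp (6 / Real.log 2) * Real.log 2 / Real.log z) := by nlinarith
    _ = 4 * Real.exp (6 / Real.log 2) * Real.log 2 / Real.log z := by ring

/-- **Hooley's Lemma 8 (rough numbers in an arithmetic progression; Brun–Titchmarsh for the
sifted progression).**  There is an absolute constant `C` such that for all `q ≥ 1`, `(b, q) = 1`,
`X ≥ 3` and `y ≥ q X³`,
`#{m ≤ y : m ≡ b (mod q), p ∣ m ⇒ p > X} ≤ C y / (φ(q) log X)`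
(stated for an arbitrary finite set `T` of such `m`, which avoids a decidability instance for the
roughness predicate).
(Zehavi 2020, Lemma 3.6, quoting [Hooley 1964, Lemma 8]: "If `a`, `λ` and `y` satisfy the conditions
`y ≥ x^{2/3}`, `λ ≤ x^{1/3}` and `(a, λ) = 1`, then `∑_{ℓ₂ ≤ y, ℓ₂ ≡ a (λ)} …`", `ℓ₂` running over the
integers all of whose prime factors exceed `X = x^{1/v}`; the displayed right-hand side is not in
the held text layer, and the form proved here, `O(y/(φ(q) log X))` under `y ≥ q X³` — which covers
Hooley's range `y/λ ≥ x^{1/3} = X^{v/3}` — is the standard sieve bound that the assembly consumes.)  Proof: the Fundamental Lemma (`SieveSequence.fundamental_lemma_uniform_holds`, dimension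
`1`) for `apSeq q b` sifted by the primes `< X` at level `D = X²`, with `|R_d| ≤ 2`
(`abs_remainder_apSeq_le`), `V(X) ≤ (q/φ(q)) C₀ / log X`, `C₀ = 4 e^{6/log 2} log 2` (`densityProduct_apSeq_le`,
`prod_primesBelow_one_sub_inv_le`) and `X² ≤ y/(φ(q) log X)`.
[cite: Hooley1964, Lemma 8 (per Zehavi arXiv:2003.13100, Lemma 3.6)] -/
theorem card_rough_congr_le :
    ∃ C : ℝ, 0 < C ∧ ∀ (q b : ℕ), 0 < q → b.Coprime q → ∀ (X y : ℝ), 3 ≤ X →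
      (q : ℝ) * X ^ 3 ≤ y → ∀ T : Finset ℕ,
      (∀ m ∈ T, m ≠ 0 ∧ (m : ℝ) ≤ y ∧ m ≡ b [MOD q] ∧ ∀ p : ℕ, p.Prime → p ∣ m → X < (p : ℝ)) →
      (#T : ℝ) ≤ C * y / ((φ q : ℝ) * Real.log X) := by
  obtain ⟨K, hK⟩ := hasSieveDimension_reciprocalDensity_one_holds
  obtain ⟨C, hC, hFL⟩ := SieveSequence.fundamental_lemma_uniform_holds 1 K
  have hC₀ : (0 : ℝ) < 4 * Real.exp (6 / Real.log 2) * Real.log 2 := by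
    have := Real.log_pos (show (1 : ℝ) < 2 by norm_num)
    positivity
  refine ⟨(1 + C) * (4 * Real.exp (6 / Real.log 2) * Real.log 2) + 2, by positivity,
    fun q b hq hbq X y hX hy T hT => ?_⟩
  -- the progression `b mod q` as a sifted sequence (an explicit term; no definition)
  let A : SieveSequence :=
    { a := fun n : ℕ => if n ≡ b [MOD q] then (1 : ℝ) else 0
      a_nonneg := fun n => by
        by_cases h : n ≡ b [MOD q]
        · simp [h]
        · simp [h]
      size := fun y : ℝ => y / (q : ℝ)
      density := ⟨fun d : ℕ => if d ≠ 0 ∧ d.Coprime q then (d : ℝ)⁻¹ else 0, by simp⟩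
      density_mult := isMultiplicative_apDensity q }
  have hAa : ∀ n : ℕ, A.a n = if n ≡ b [MOD q] then 1 else 0 := fun n => rfl
  have hAs : ∀ y : ℝ, A.size y = y / q := fun y => rfl
  have hAd : ∀ d : ℕ, A.density d = if d ≠ 0 ∧ d.Coprime q then (d : ℝ)⁻¹ else 0 := fun d => rfl
  have hdim : HasSieveDimension A.density 1 K := hasSieveDimension_apDensity hAd hK
  have hX2 : (2 : ℝ) ≤ X := by linarith
  have hX0 : (0 : ℝ) < X := by linarith
  have hXD : X ≤ X ^ 2 := by nlinarith
  have hq0 : (0 : ℝ) < q := by exact_mod_cast hq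
  have hq1 : (1 : ℝ) ≤ q := by exact_mod_cast hq
  have hy0 : 0 ≤ y := le_trans (by positivity) hy
  have hsize : 0 ≤ A.size y := by rw [hAs]; exact div_nonneg hy0 hq0.le
  have hφ0 : (0 : ℝ) < φ q := by exact_mod_cast Nat.totient_pos.2 hq
  have hlogX : 0 < Real.log X := Real.log_pos (by linarith)
  set V := A.densityProduct (primesProdBelow X) with hVdef
  have hV0 : 0 ≤ V := Finset.prod_nonneg fun p hp =>
    sub_nonneg.2 (hdim.1 p (Nat.prime_of_mem_primeFactors hp)).2.le
  -- the Fundamental Lemma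
  have hfl := hFL A hdim y X (X ^ 2) hX2 hXD hsize
  have hexp : Real.exp (-(Real.log (X ^ 2) / Real.log X)) ≤ 1 := by
    rw [Real.exp_le_one_iff, neg_nonpos]
    exact div_nonneg (Real.log_nonneg (by nlinarith)) hlogX.le
  -- the remainder sum
  have hrem : ∑ d ∈ (primesProdBelow X).divisors.filter (fun d : ℕ => (d : ℝ) ≤ X ^ 2),
      |A.remainder d y| ≤ 2 * X ^ 2 := by
    calc ∑ d ∈ (primesProdBelow X).divisors.filter (fun d : ℕ => (d : ℝ) ≤ X ^ 2), |A.remainder d y|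
        ≤ ∑ d ∈ (primesProdBelow X).divisors.filter (fun d : ℕ => (d : ℝ) ≤ X ^ 2), (2 : ℝ) :=
          Finset.sum_le_sum fun d _ => abs_remainder_apSeq_le hAa hAs hAd hq hbq d hy0
      _ = 2 * #((primesProdBelow X).divisors.filter (fun d : ℕ => (d : ℝ) ≤ X ^ 2)) := by
          rw [Finset.sum_const, nsmul_eq_mul, mul_comm]
      _ ≤ 2 * #(Icc 1 ⌊X ^ 2⌋₊) := by
          gcongr
          intro d hd
          rw [Finset.mem_filter] at hd
          rw [Finset.mem_Icc]
          exact ⟨Nat.pos_of_mem_divisors hd.1, Nat.le_floor hd.2⟩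
      _ ≤ 2 * X ^ 2 := by
          rw [Nat.card_Icc, Nat.add_sub_cancel]
          exact mul_le_mul_of_nonneg_left (Nat.floor_le (by positivity)) (by norm_num)
  -- the main term
  have hVle : V ≤ (q : ℝ) / φ q * ((4 * Real.exp (6 / Real.log 2) * Real.log 2) / Real.log X) :=
    (densityProduct_apSeq_le hAd hq X).trans
      (mul_le_mul_of_nonneg_left (prod_primesBelow_one_sub_inv_le hX) (by positivity))
  have hS : A.sifted y (primesProdBelow X) ≤ (1 + C) * (A.size y * V) + 2 * X ^ 2 := by
    have h1 := (abs_le.1 hfl).2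
    have h2 : C * A.size y * V * Real.exp (-(Real.log (X ^ 2) / Real.log X)) ≤ C * A.size y * V :=
      mul_le_of_le_one_right (by positivity) hexp
    linarith
  have hmain : (1 + C) * (A.size y * V) ≤
      (1 + C) * (4 * Real.exp (6 / Real.log 2) * Real.log 2) * y / ((φ q : ℝ) * Real.log X) := by
    rw [hAs]
    have : y / q * V ≤ y / q * ((q : ℝ) / φ q *
        ((4 * Real.exp (6 / Real.log 2) * Real.log 2) / Real.log X)) :=
      mul_le_mul_of_nonneg_left hVle (div_nonneg hy0 hq0.le)
    calc (1 + C) * (y / q * V) ≤ (1 + C) * (y / q * ((q : ℝ) / φ q *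
          ((4 * Real.exp (6 / Real.log 2) * Real.log 2) / Real.log X))) :=
          mul_le_mul_of_nonneg_left this (by positivity)
      _ = (1 + C) * (4 * Real.exp (6 / Real.log 2) * Real.log 2) * y / ((φ q : ℝ) * Real.log X) := by
          field_simp
  -- `2 X² ≤ 2 y / (φ(q) log X)`
  have htail : 2 * X ^ 2 ≤ 2 * y / ((φ q : ℝ) * Real.log X) := by
    rw [le_div_iff₀ (by positivity)]
    have hφq : (φ q : ℝ) ≤ q := by exact_mod_cast Nat.totient_le q
    have hlogle : Real.log X ≤ X := by linarith [Real.log_le_sub_one_of_pos hX0]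
    calc 2 * X ^ 2 * ((φ q : ℝ) * Real.log X) ≤ 2 * X ^ 2 * ((q : ℝ) * X) := by
          gcongr
      _ = 2 * ((q : ℝ) * X ^ 3) := by ring
      _ ≤ 2 * y := by linarith
  calc (#T : ℝ) ≤ A.sifted y (primesProdBelow X) := card_rough_congr_le_sifted hAa X y hT
    _ ≤ (1 + C) * (A.size y * V) + 2 * X ^ 2 := hS
    _ ≤ (1 + C) * (4 * Real.exp (6 / Real.log 2) * Real.log 2) * y / ((φ q : ℝ) * Real.log X) + 2 * y / ((φ q : ℝ) * Real.log X) :=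
        add_le_add hmain htail
    _ = ((1 + C) * (4 * Real.exp (6 / Real.log 2) * Real.log 2) + 2) * y / ((φ q : ℝ) * Real.log X) := by ring

end Literature.NumberTheory.Sieve
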